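import Summits.QuantumFields.BalabanUV.Beta.EriceFlowEnclosureCesaroTauberianSeq

/-!
# Beta / EriceFlowEnclosureWeightedTauberianSeq — SCHMIDT'S TAUBERIAN THEOREM FOR WEIGHTED CUTOFF AVERAGES `(Σ_{n<N} p n·a n)∕(Σ_{n<N} p n)`:
# POSITIVE WEIGHTS WHOSE MASS GROWS BY A FACTOR ρ(q) > 1 ACROSS EVERY WINDOW [N, qN] KEEP THE ORDINARY TAUBERIAN CLASS — weighted mean → m +
# slow decrease ⟹ a → m (pure [folklore] SERVICE for the BARE ∕ CUTOFF side of rows L131–L142; imports P2 #53a only; the power weights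
# `p n = (n+1)^σ`, −1 < σ ≤ 0, are the instance P2 #54d `EriceFlowEnclosureWeightedTauberianPower`).
# For a real sequence a and weights p ≥ 0 with `P N := Σ_{n<N} p n → ∞`, the WEIGHTED MEAN is `W N := (Σ_{n<N} p n·a n)∕P N`:
#   §1 ONE SCALE — the window sums `(P J − P N)(a N − w) ≤ S J − S N`, `S N − S I ≤ (P N − P I)·c`, the quotient estimate
#      `|(S J − S N)∕(P J − P N) − m| ≤ (P J·E₂ + P N·E₁)∕(P J − P N)` (`quot_abs_le`, pure real algebra), its size `≤ ε∕2` once `P J ≥ ρ·P N` and the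
#      means are within `η = (ε∕2)(ρ − 1)∕(ρ + 1)` (`quot_eta_le`), and the one-sided bounds `wupper_of_window` ∕ `wlower_of_window`;
#   §2 ABELIAN (regularity) — `a → m ⟹ W → m` for any p ≥ 0 with P → ∞ (`weightedMean_of_tendsto`);
#   §3 TAUBERIAN — under the GROWTH CONDITION (G) «∀ q > 1 ∃ ρ > 1 ∃ N₁ ∀ N ≥ N₁ ∀ J ≥ qN: ρ·P N ≤ P J» (the mass is NOT slowly varying):
#      **`W → m` + one-sided slow decrease `a N − ε ≤ a i` (N₀ ≤ N ≤ i ≤ qN) ⟹ `a → m`** (HEADLINE `tendsto_of_weightedMean_slowlyDecreasing`; windows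
#      [N, ⌊qN⌋[ and [⌈N∕q⌉, N[ as in P2 #53a, growth taken at ratio q′ = (1 + q)∕2); two-sided (SO) form and **`W → m ⟺ a → m` in (SO)**
#      (`weightedMean_iff_tendsto_of_slowlyOscillating`);
#   WHICH WEIGHTS (P2 #54d): (G) holds when `P N∕N^α → c > 0` with α > 0 (mass regularly varying of POSITIVE index) — p ≡ 1 ((C,1), α = 1) and
#      the power weights `(n+1)^σ`, −1 < σ ≤ 0 (α = σ + 1); the boundary σ = −1 (logarithmic means, mass `log N`, index 0) VIOLATES (G), and there
#      the theorem FAILS in the ordinary class (P2 #54e's witness `sin(log n)`): the Tauberian class must then shrink to slow decrease on the POWER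
#      scales N → N^λ (Kwee 1967 ∕ Móricz 2013, in the tree as `Literature.Analysis.Asymptotics.Moricz2013_corollary3_holds`).
# (β-flow team, prover 2 = lower ∕ positivity side, unit `b2b-balaban-beta-bflow-p2`, gen 37; module P2 #54c; no Erice sentence occurs)

HONEST FRAMING (page 1 of everything the β sub-cell writes): discharging `BetaPertH` makes Bałaban's UV stability UNCONDITIONAL — a
real constructive-QFT result; it is NOT the continuum limit and NOT the Clay problem.  HONEST DEPENDENCY (cell reorg 2026-08-19,
verbatim): «continuum YM on T⁴ ⇐ BetaPertH ∧ nine spine estimates (0/9 proved); BetaPertH ⇐ (D1) ∧ (D4) ∧ CAP+tail; G-an2-4 gates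
asym, D1 and NE2/3/4.»  THIS MODULE DISCHARGES NOTHING and quotes nothing: [folklore] real analysis about real sequences (R. Schmidt, Math. Z.
22 (1925) 89–152 — slow decrease; G. H. Hardy, Divergent Series (1949) §3.8 Thm 14 (regularity of the weighted means `(N̄, p_n)`), §§6.1–6.3,
Thm 68; the growth form of the Tauberian condition is the classical one for Riesz's typical means).  `lean search` finds the (C,1) case (P2 #53a)
and the logarithmic case (`Literature.Analysis.Asymptotics.LogarithmicSummabilityTauberianProofs`) in the tree, no general weighted form.

THE POINT.  With weights, `S J − S N = Σ_{N≤i<J} p i·a i` still lies between `(P J − P N)(a N ∓ w)` on a window where the values stay within w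
of a N, and `(S J − S N)∕(P J − P N) − m = (P J(W J − m) − P N(W N − m))∕(P J − P N)` is `≤ (ρ + 1)∕(ρ − 1)·η` once `P J ≥ ρ·P N` and the means
are within η of m.  So only a LOWER bound on the growth of the mass across the window is needed — (G) — and it is exactly what separates the
power weights (index α > 0: `P(qN)∕P(N) → q^α > 1`) from the logarithmic ones (index 0: `log(qN)∕log N → 1`).

WHAT THIS FILE PROVES (0 sorry, 0 def): §1 `wsum_window_lower`, `wsum_window_upper`, `quot_abs_le`, `quot_eta_le`, `wupper_of_window`,
`wlower_of_window`; §2 **`weightedMean_of_tendsto`**; §3 HEADLINE **`tendsto_of_weightedMean_slowlyDecreasing`**,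
**`tendsto_of_weightedMean_slowlyOscillating`**, **`weightedMean_iff_tendsto_of_slowlyOscillating`**.
NOT CLAIMED: necessity of (G); the instances (P2 #54d); slowly varying masses (the logarithmic method is P2 #54e, by name over Móricz); Nörlund
means; anything about β-functions (the consumer instantiates a = the sampled datum along the bare couplings, P2 #54f); `BetaPertH`; continuum; Clay.
-/

namespace Summit.QuantumFields.BalabanUV.Beta.EriceFlowEnclosureWeightedTauberianSeq

open Finset Filter Topology
open Summit.QuantumFields.BalabanUV.Beta.EriceFlowEnclosureCesaroTauberianSeq

noncomputable section

variable {a p : ℕ → ℝ}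

/-! ## §1 One scale with weights -/

/-- LOWER WINDOW BOUND (weighted): p ≥ 0, N ≤ J, `a N − w ≤ a i` for `N ≤ i < J` ⟹ `(P J − P N)(a N − w) ≤ S J − S N`. [folklore] -/
theorem wsum_window_lower (hp : ∀ n, 0 ≤ p n) {N J : ℕ} (hNJ : N ≤ J) {w : ℝ}
    (hw : ∀ i, N ≤ i → i < J → a N - w ≤ a i) :
    (∑ n ∈ range J, p n - ∑ n ∈ range N, p n) * (a N - w) ≤
      ∑ n ∈ range J, p n * a n - ∑ n ∈ range N, p n * a n := by
  rw [← sum_Ico_eq_sub _ hNJ, ← sum_Ico_eq_sub _ hNJ, sum_mul]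
  exact sum_le_sum fun i hi => mul_le_mul_of_nonneg_left (hw i (mem_Ico.mp hi).1 (mem_Ico.mp hi).2) (hp i)

/-- UPPER WINDOW BOUND BY A CONSTANT (weighted): p ≥ 0, I ≤ N, `a i ≤ c` for `I ≤ i < N` ⟹ `S N − S I ≤ (P N − P I)·c`. [folklore] -/
theorem wsum_window_upper (hp : ∀ n, 0 ≤ p n) {I N : ℕ} (hIN : I ≤ N) {c : ℝ}
    (hw : ∀ i, I ≤ i → i < N → a i ≤ c) :
    ∑ n ∈ range N, p n * a n - ∑ n ∈ range I, p n * a n ≤ (∑ n ∈ range N, p n - ∑ n ∈ range I, p n) * c := by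
  rw [← sum_Ico_eq_sub _ hIN, ← sum_Ico_eq_sub _ hIN, sum_mul]
  exact sum_le_sum fun i hi => mul_le_mul_of_nonneg_left (hw i (mem_Ico.mp hi).1 (mem_Ico.mp hi).2) (hp i)

/-- THE QUOTIENT ESTIMATE (pure real algebra): `0 < PN < PJ`, `|SJ∕PJ − m| ≤ E₂`, `|SN∕PN − m| ≤ E₁` ⟹
`|(SJ − SN)∕(PJ − PN) − m| ≤ (PJ·E₂ + PN·E₁)∕(PJ − PN)`, from `(SJ − SN)∕(PJ − PN) − m = (PJ(SJ∕PJ − m) − PN(SN∕PN − m))∕(PJ − PN)`. [folklore] -/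
theorem quot_abs_le {PN PJ SN SJ m E₁ E₂ : ℝ} (hPN : 0 < PN) (hPJ : PN < PJ)
    (hJ : |SJ / PJ - m| ≤ E₂) (hN : |SN / PN - m| ≤ E₁) :
    |(SJ - SN) / (PJ - PN) - m| ≤ (PJ * E₂ + PN * E₁) / (PJ - PN) := by
  have hPJ0 : 0 < PJ := hPN.trans hPJ
  have hd : 0 < PJ - PN := sub_pos.mpr hPJ
  have hid : (SJ - SN) / (PJ - PN) - m = (PJ * (SJ / PJ - m) - PN * (SN / PN - m)) / (PJ - PN) := by
    field_simp
    ring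
  rw [hid, abs_div, abs_of_pos hd, div_le_div_iff_of_pos_right hd]
  calc |PJ * (SJ / PJ - m) - PN * (SN / PN - m)| ≤ |PJ * (SJ / PJ - m)| + |PN * (SN / PN - m)| := abs_sub _ _
    _ = PJ * |SJ / PJ - m| + PN * |SN / PN - m| := by rw [abs_mul, abs_mul, abs_of_pos hPJ0, abs_of_pos hPN]
    _ ≤ PJ * E₂ + PN * E₁ := add_le_add (mul_le_mul_of_nonneg_left hJ hPJ0.le) (mul_le_mul_of_nonneg_left hN hPN.le)

/-- THE SIZE OF THE QUOTIENT ERROR: `0 < PN`, `ρ > 1`, `ρ·PN ≤ PJ`, `η = (ε∕2)(ρ − 1)∕(ρ + 1)` ⟹ `(PJ·η + PN·η)∕(PJ − PN) ≤ ε∕2`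
(`(PJ + PN)∕(PJ − PN) ≤ (ρ + 1)∕(ρ − 1)` since `t ↦ (t + 1)∕(t − 1)` decreases). [folklore] -/
theorem quot_eta_le {PN PJ ρ η ε : ℝ} (hPN : 0 < PN) (hρ : 1 < ρ) (hε : 0 < ε) (hPJ : ρ * PN ≤ PJ)
    (hη : η = ε / 2 * (ρ - 1) / (ρ + 1)) : (PJ * η + PN * η) / (PJ - PN) ≤ ε / 2 := by
  have hlt : PN < PJ := by nlinarith
  have hρ1 : 0 < ρ + 1 := by linarith
  rw [div_le_iff₀ (sub_pos.mpr hlt)]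
  have h1 : (PJ * η + PN * η) * (ρ + 1) = ε / 2 * (ρ - 1) * (PJ + PN) := by
    rw [hη]; field_simp
  have h2 : 0 ≤ ε * (PJ - ρ * PN) := mul_nonneg hε.le (by linarith)
  have h3 : ε / 2 * (PJ - PN) * (ρ + 1) - ε / 2 * (ρ - 1) * (PJ + PN) = ε * (PJ - ρ * PN) := by ring
  have key : (PJ * η + PN * η) * (ρ + 1) ≤ ε / 2 * (PJ - PN) * (ρ + 1) := by rw [h1]; linarith
  exact le_of_mul_le_mul_right key hρ1

/-- **UPPER BOUND FROM THE UPPER WINDOW** (weighted, one-sided): N ≤ J, `0 < P N < P J`, `a N − w ≤ a i` on [N, J[, the means at J and N within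
E₂, E₁ of m ⟹ `a N ≤ m + w + (P J·E₂ + P N·E₁)∕(P J − P N)`. [folklore] -/
theorem wupper_of_window (hp : ∀ n, 0 ≤ p n) {N J : ℕ} (hNJ : N ≤ J)
    (hPN : 0 < ∑ n ∈ range N, p n) (hPJ : ∑ n ∈ range N, p n < ∑ n ∈ range J, p n) {w m E₁ E₂ : ℝ}
    (hw : ∀ i, N ≤ i → i < J → a N - w ≤ a i)
    (hJ : |(∑ n ∈ range J, p n * a n) / (∑ n ∈ range J, p n) - m| ≤ E₂)
    (hN : |(∑ n ∈ range N, p n * a n) / (∑ n ∈ range N, p n) - m| ≤ E₁) :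
    a N ≤ m + w + ((∑ n ∈ range J, p n) * E₂ + (∑ n ∈ range N, p n) * E₁) /
      (∑ n ∈ range J, p n - ∑ n ∈ range N, p n) := by
  have hd : 0 < ∑ n ∈ range J, p n - ∑ n ∈ range N, p n := sub_pos.mpr hPJ
  have h1 := wsum_window_lower hp hNJ hw
  have h2 := (abs_le.mp (quot_abs_le hPN hPJ hJ hN)).2
  have h3 : a N - w ≤ (∑ n ∈ range J, p n * a n - ∑ n ∈ range N, p n * a n) /
      (∑ n ∈ range J, p n - ∑ n ∈ range N, p n) := by
    rw [le_div_iff₀ hd]; linarith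
  linarith

/-- **LOWER BOUND FROM THE LOWER WINDOW** (weighted, one-sided): I ≤ N, `0 < P I < P N`, `a i − w ≤ a N` on [I, N[, the means at N and I within
E₁, E₀ of m ⟹ `m − w − (P N·E₁ + P I·E₀)∕(P N − P I) ≤ a N`. [folklore] -/
theorem wlower_of_window (hp : ∀ n, 0 ≤ p n) {I N : ℕ} (hIN : I ≤ N)
    (hPI : 0 < ∑ n ∈ range I, p n) (hPIN : ∑ n ∈ range I, p n < ∑ n ∈ range N, p n) {w m E₀ E₁ : ℝ}
    (hw : ∀ i, I ≤ i → i < N → a i - w ≤ a N)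
    (hN : |(∑ n ∈ range N, p n * a n) / (∑ n ∈ range N, p n) - m| ≤ E₁)
    (hI : |(∑ n ∈ range I, p n * a n) / (∑ n ∈ range I, p n) - m| ≤ E₀) :
    m - w - ((∑ n ∈ range N, p n) * E₁ + (∑ n ∈ range I, p n) * E₀) /
      (∑ n ∈ range N, p n - ∑ n ∈ range I, p n) ≤ a N := by
  have hd : 0 < ∑ n ∈ range N, p n - ∑ n ∈ range I, p n := sub_pos.mpr hPIN
  have h1 : ∑ n ∈ range N, p n * a n - ∑ n ∈ range I, p n * a n ≤
      (∑ n ∈ range N, p n - ∑ n ∈ range I, p n) * (a N + w) :=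
    wsum_window_upper hp hIN fun i hi1 hi2 => by have := hw i hi1 hi2; linarith
  have h2 := (abs_le.mp (quot_abs_le hPI hPIN hN hI)).1
  have h3 : (∑ n ∈ range N, p n * a n - ∑ n ∈ range I, p n * a n) /
      (∑ n ∈ range N, p n - ∑ n ∈ range I, p n) ≤ a N + w := by
    rw [div_le_iff₀ hd]; linarith
  linarith

/-! ## §2 The Abelian direction: positive weights of divergent mass are regular -/

/-- **REGULARITY**: p ≥ 0, `P N → ∞`, `a n → m` ⟹ `(Σ_{n<N} p n·a n)∕P N → m`. [folklore] (Hardy, Divergent Series Thm 14 for the `(N̄, p_n)` means) -/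
theorem weightedMean_of_tendsto (hp : ∀ n, 0 ≤ p n) (hP : Tendsto (fun N => ∑ n ∈ range N, p n) atTop atTop)
    {m : ℝ} (ha : Tendsto a atTop (𝓝 m)) :
    Tendsto (fun N => (∑ n ∈ range N, p n * a n) / ∑ n ∈ range N, p n) atTop (𝓝 m) := by
  rw [Metric.tendsto_atTop]
  intro ε hε
  obtain ⟨N₀, hN₀⟩ := Metric.tendsto_atTop.mp ha (ε / 2) (by linarith)
  set H : ℝ := ∑ n ∈ range N₀, p n * |a n - m| with hH
  have hH0 : 0 ≤ H := sum_nonneg fun n _ => mul_nonneg (hp n) (abs_nonneg _)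
  obtain ⟨N₁, hN₁⟩ := tendsto_atTop_atTop.mp hP (max 1 (4 * H / ε))
  refine ⟨max N₀ N₁, fun N hN => ?_⟩
  have hN0 : N₀ ≤ N := le_trans (le_max_left _ _) hN
  have hPN := hN₁ N (le_trans (le_max_right _ _) hN)
  have hP1 : 1 ≤ ∑ n ∈ range N, p n := le_trans (le_max_left _ _) hPN
  have hP0 : 0 < ∑ n ∈ range N, p n := by linarith
  have hPH : 4 * H / ε ≤ ∑ n ∈ range N, p n := le_trans (le_max_right _ _) hPN
  have hPH' : H ≤ ε / 4 * ∑ n ∈ range N, p n := by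
    rw [div_le_iff₀ hε] at hPH; linarith
  have hid : (∑ n ∈ range N, p n * a n) / (∑ n ∈ range N, p n) - m =
      (∑ n ∈ range N, p n * (a n - m)) / ∑ n ∈ range N, p n := by
    rw [eq_div_iff hP0.ne', sub_mul, div_mul_cancel₀ _ hP0.ne']
    simp only [mul_sub, sum_sub_distrib, ← sum_mul]
    ring
  rw [Real.dist_eq, hid, abs_div, abs_of_pos hP0, div_lt_iff₀ hP0]
  have hsplit : ∑ n ∈ range N, p n * (a n - m) =
      ∑ n ∈ range N₀, p n * (a n - m) + ∑ n ∈ Ico N₀ N, p n * (a n - m) :=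
    (sum_range_add_sum_Ico _ hN0).symm
  have hhead : |∑ n ∈ range N₀, p n * (a n - m)| ≤ H := by
    refine (abs_sum_le_sum_abs _ _).trans (le_of_eq ?_)
    rw [hH]; exact sum_congr rfl fun n _ => by rw [abs_mul, abs_of_nonneg (hp n)]
  have htail : |∑ n ∈ Ico N₀ N, p n * (a n - m)| ≤ ε / 2 * ∑ n ∈ range N, p n := by
    refine (abs_sum_le_sum_abs _ _).trans ?_
    have h1 : ∑ n ∈ Ico N₀ N, |p n * (a n - m)| ≤ ∑ n ∈ Ico N₀ N, p n * (ε / 2) := by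
      refine sum_le_sum fun n hn => ?_
      rw [abs_mul, abs_of_nonneg (hp n)]
      have := hN₀ n (mem_Ico.mp hn).1; rw [Real.dist_eq] at this
      exact mul_le_mul_of_nonneg_left this.le (hp n)
    have hsub : Ico N₀ N ⊆ range N := by
      rw [range_eq_Ico]; exact Ico_subset_Ico (Nat.zero_le _) le_rfl
    have h2 : ∑ n ∈ Ico N₀ N, p n * (ε / 2) ≤ ε / 2 * ∑ n ∈ range N, p n := by
      rw [← sum_mul, mul_comm]
      exact mul_le_mul_of_nonneg_left (sum_le_sum_of_subset_of_nonneg hsub fun n _ _ => hp n) (by linarith)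
    linarith
  rw [hsplit]
  have := abs_add_le (∑ n ∈ range N₀, p n * (a n - m)) (∑ n ∈ Ico N₀ N, p n * (a n - m))
  have hεP : 0 < ε * ∑ n ∈ range N, p n := mul_pos hε hP0
  linarith

/-! ## §3 The Tauberian theorem under the growth condition (G) -/

/-- **SCHMIDT'S TAUBERIAN THEOREM FOR WEIGHTED MEANS (HEADLINE).**  p ≥ 0 with `P N = Σ_{n<N} p n → ∞` and the GROWTH CONDITION (G): for every
q > 1 there are ρ > 1 and N₁ with `ρ·P N ≤ P J` whenever `N₁ ≤ N` and `q·N ≤ J`.  If the weighted means `(Σ_{n<N} p n·a n)∕P N → m` and a is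
SLOWLY DECREASING — for every ε > 0 there are q > 1 and N₀ with `a N − ε ≤ a i` whenever `N₀ ≤ N ≤ i ≤ q·N` — then **`a n → m`**.  Upper bound
from the window [N, ⌊qN⌋[, lower bound from [⌈N∕q⌉, N[ (P2 #53a `upper_index` ∕ `lower_index`); the growth is taken at ratio q′ = (1 + q)∕2, which both
windows afford, and makes the quotient errors `≤ ε∕2` (`quot_eta_le`). [folklore] (R. Schmidt 1925 for p ≡ 1; Hardy, Divergent Series §6.1) -/
theorem tendsto_of_weightedMean_slowlyDecreasing (hp : ∀ n, 0 ≤ p n)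
    (hP : Tendsto (fun N => ∑ n ∈ range N, p n) atTop atTop)
    (hG : ∀ q > (1:ℝ), ∃ ρ > (1:ℝ), ∃ N₁ : ℕ, ∀ N J : ℕ, N₁ ≤ N → q * N ≤ (J : ℝ) →
      ρ * (∑ n ∈ range N, p n) ≤ ∑ n ∈ range J, p n)
    {m : ℝ} (hmean : Tendsto (fun N => (∑ n ∈ range N, p n * a n) / ∑ n ∈ range N, p n) atTop (𝓝 m))
    (hsd : ∀ ε > 0, ∃ q > (1:ℝ), ∃ N₀ : ℕ, ∀ N i : ℕ, N₀ ≤ N → N ≤ i → (i : ℝ) ≤ q * N → a N - ε ≤ a i) :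
    Tendsto a atTop (𝓝 m) := by
  rw [Metric.tendsto_atTop] at hmean
  obtain ⟨Np, hNp⟩ := tendsto_atTop_atTop.mp hP 1
  -- UPPER: ∀ ε > 0, eventually a N ≤ m + ε
  have hup : ∀ ε > 0, ∀ᶠ N in atTop, a N ≤ m + ε := by
    intro ε hε
    obtain ⟨q, hq, N₀, hsd'⟩ := hsd (ε / 2) (by linarith)
    have hq1 : 0 < q - 1 := by linarith
    obtain ⟨ρ, hρ, N₁, hG'⟩ := hG ((1 + q) / 2) (by linarith)
    set η := ε / 2 * (ρ - 1) / (ρ + 1) with hη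
    have hη0 : 0 < η := by rw [hη]; exact div_pos (mul_pos (by linarith) (by linarith)) (by linarith)
    obtain ⟨N₂, hN₂⟩ := hmean η hη0
    refine eventually_atTop.2 ⟨max (max (max N₀ N₁) (max N₂ Np)) ⌈2 / (q - 1)⌉₊, fun N hN => ?_⟩
    have hA : max (max N₀ N₁) (max N₂ Np) ≤ N := le_trans (le_max_left _ _) hN
    have hN0 : N₀ ≤ N := le_trans (le_trans (le_max_left _ _) (le_max_left _ _)) hA
    have hN1 : N₁ ≤ N := le_trans (le_trans (le_max_right _ _) (le_max_left _ _)) hA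
    have hN2 : N₂ ≤ N := le_trans (le_trans (le_max_left _ _) (le_max_right _ _)) hA
    have hNp' : Np ≤ N := le_trans (le_trans (le_max_right _ _) (le_max_right _ _)) hA
    have hNc : ⌈2 / (q - 1)⌉₊ ≤ N := le_trans (le_max_right _ _) hN
    have hN' : 2 ≤ (q - 1) * N := by
      have h : 2 / (q - 1) ≤ N := le_trans (Nat.le_ceil _) (Nat.cast_le.mpr hNc)
      rw [div_le_iff₀ hq1] at h; linarith
    obtain ⟨hNJ, hJq, hJN⟩ := upper_index hq hN'
    set J := ⌊q * (N : ℝ)⌋₊ with hJ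
    have hq'J : (1 + q) / 2 * N ≤ (J : ℝ) := by
      have : (1 + q) / 2 * (N : ℝ) = N + (q - 1) * N / 2 := by ring
      linarith
    have hPNJ' := hG' N J hN1 hq'J
    have hPN1 : 1 ≤ ∑ n ∈ range N, p n := hNp N hNp'
    have hPN0 : 0 < ∑ n ∈ range N, p n := by linarith
    have hEJ : |(∑ n ∈ range J, p n * a n) / (∑ n ∈ range J, p n) - m| ≤ η := by
      have := hN₂ J (hN2.trans hNJ.le); rw [Real.dist_eq] at this; exact this.le
    have hEN : |(∑ n ∈ range N, p n * a n) / (∑ n ∈ range N, p n) - m| ≤ η := by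
      have := hN₂ N hN2; rw [Real.dist_eq] at this; exact this.le
    have hw : ∀ i, N ≤ i → i < J → a N - ε / 2 ≤ a i := fun i h1 h2 =>
      hsd' N i hN0 h1 (le_trans (Nat.cast_le.mpr h2.le) hJq)
    have hPNJ : ∑ n ∈ range N, p n < ∑ n ∈ range J, p n := by nlinarith
    have h := wupper_of_window hp hNJ.le hPN0 hPNJ hw hEJ hEN
    have hquot := quot_eta_le hPN0 hρ hε hPNJ' hη
    linarith
  -- LOWER: ∀ ε > 0, eventually m − ε ≤ a N
  have hlo : ∀ ε > 0, ∀ᶠ N in atTop, m - ε ≤ a N := by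
    intro ε hε
    obtain ⟨q, hq, N₀, hsd'⟩ := hsd (ε / 2) (by linarith)
    have hq0 : 0 < q := by linarith
    have hq1 : 0 < q - 1 := by linarith
    obtain ⟨ρ, hρ, N₁, hG'⟩ := hG ((1 + q) / 2) (by linarith)
    set η := ε / 2 * (ρ - 1) / (ρ + 1) with hη
    have hη0 : 0 < η := by rw [hη]; exact div_pos (mul_pos (by linarith) (by linarith)) (by linarith)
    obtain ⟨N₂, hN₂⟩ := hmean η hη0
    set M : ℕ := max (max N₀ N₁) (max N₂ Np) with hM
    refine eventually_atTop.2 ⟨max (max N₂ ⌈q * (M : ℝ)⌉₊) ⌈q * (q + 1) / (q - 1)⌉₊, fun N hN => ?_⟩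
    have hN2 : N₂ ≤ N := le_trans (le_max_left _ _) (le_trans (le_max_left _ _) hN)
    have hNq : q * (M : ℝ) ≤ N :=
      le_trans (Nat.le_ceil _) (Nat.cast_le.mpr (le_trans (le_max_right _ _) (le_trans (le_max_left _ _) hN)))
    have hNc : ⌈q * (q + 1) / (q - 1)⌉₊ ≤ N := le_trans (le_max_right _ _) hN
    have hN3 : q * (q + 1) ≤ (q - 1) * N := by
      have h : q * (q + 1) / (q - 1) ≤ N := le_trans (Nat.le_ceil _) (Nat.cast_le.mpr hNc)
      rw [div_le_iff₀ hq1] at h; linarith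
    have hN' : 2 * q ≤ (q - 1) * N := by nlinarith
    obtain ⟨hIN, hIq, hNI⟩ := lower_index hq hN'
    set I := ⌈(N : ℝ) / q⌉₊ with hI
    -- I ≥ N∕q ≥ M
    have hIM : ((M : ℕ) : ℝ) ≤ I := by
      have h : ((M : ℕ) : ℝ) ≤ (N : ℝ) / q := by rw [le_div_iff₀ hq0]; linarith
      exact h.trans hIq
    have hIM' : M ≤ I := Nat.cast_le.mp hIM
    have hI0 : N₀ ≤ I := le_trans (le_trans (le_max_left _ _) (le_max_left _ _)) hIM'
    have hI1 : N₁ ≤ I := le_trans (le_trans (le_max_right _ _) (le_max_left _ _)) hIM'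
    have hI2 : N₂ ≤ I := le_trans (le_trans (le_max_left _ _) (le_max_right _ _)) hIM'
    have hIp : Np ≤ I := le_trans (le_trans (le_max_right _ _) (le_max_right _ _)) hIM'
    -- the growth from I to N at ratio q′: q′·I ≤ N since I < N∕q + 1 and q(q+1) ≤ (q−1)N
    have hIlt : (I : ℝ) < (N : ℝ) / q + 1 := Nat.ceil_lt_add_one (div_nonneg (Nat.cast_nonneg N) hq0.le)
    have hq'I : (1 + q) / 2 * I ≤ (N : ℝ) := by
      have h1 : (1 + q) / 2 * (I : ℝ) ≤ (1 + q) / 2 * ((N : ℝ) / q + 1) :=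
        mul_le_mul_of_nonneg_left hIlt.le (by linarith)
      have h2 : (1 + q) / 2 * ((N : ℝ) / q + 1) ≤ N := by
        rw [show (1 + q) / 2 * ((N : ℝ) / q + 1) = ((1 + q) * N + (1 + q) * q) / (2 * q) by
          field_simp]
        rw [div_le_iff₀ (by linarith)]; nlinarith
      linarith
    have hPIN' := hG' I N hI1 hq'I
    have hPI1 : 1 ≤ ∑ n ∈ range I, p n := hNp I hIp
    have hPI0 : 0 < ∑ n ∈ range I, p n := by linarith
    have hPIN : ∑ n ∈ range I, p n < ∑ n ∈ range N, p n := by nlinarith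
    have hEN : |(∑ n ∈ range N, p n * a n) / (∑ n ∈ range N, p n) - m| ≤ η := by
      have := hN₂ N hN2; rw [Real.dist_eq] at this; exact this.le
    have hEI : |(∑ n ∈ range I, p n * a n) / (∑ n ∈ range I, p n) - m| ≤ η := by
      have := hN₂ I hI2; rw [Real.dist_eq] at this; exact this.le
    have hw : ∀ i, I ≤ i → i < N → a i - ε / 2 ≤ a N := by
      intro i h1 h2
      have hiq : (N : ℝ) ≤ q * i := by
        have : (N : ℝ) / q ≤ i := hIq.trans (Nat.cast_le.mpr h1)
        rw [div_le_iff₀ hq0] at this; linarith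
      exact hsd' i N (hI0.trans h1) h2.le hiq
    have h := wlower_of_window hp hIN.le hPI0 hPIN hw hEN hEI
    have hquot := quot_eta_le hPI0 hρ hε hPIN' hη
    linarith
  refine tendsto_order.2 ⟨fun b hb => ?_, fun b hb => ?_⟩
  · filter_upwards [hlo ((m - b) / 2) (by linarith)] with N hN
    linarith
  · filter_upwards [hup ((b - m) / 2) (by linarith)] with N hN
    linarith

/-- **THE WEIGHTED TAUBERIAN THEOREM UNDER SLOW OSCILLATION**: (G), P → ∞, `W → m`, and (SO) `|a i − a N| ≤ ε` for `N₀ ≤ N ≤ i ≤ qN` ⟹ `a → m`.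
[folklore] -/
theorem tendsto_of_weightedMean_slowlyOscillating (hp : ∀ n, 0 ≤ p n)
    (hP : Tendsto (fun N => ∑ n ∈ range N, p n) atTop atTop)
    (hG : ∀ q > (1:ℝ), ∃ ρ > (1:ℝ), ∃ N₁ : ℕ, ∀ N J : ℕ, N₁ ≤ N → q * N ≤ (J : ℝ) →
      ρ * (∑ n ∈ range N, p n) ≤ ∑ n ∈ range J, p n)
    {m : ℝ} (hmean : Tendsto (fun N => (∑ n ∈ range N, p n * a n) / ∑ n ∈ range N, p n) atTop (𝓝 m))
    (hso : ∀ ε > 0, ∃ q > (1:ℝ), ∃ N₀ : ℕ, ∀ N i : ℕ, N₀ ≤ N → N ≤ i → (i : ℝ) ≤ q * N → |a i - a N| ≤ ε) :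
    Tendsto a atTop (𝓝 m) := by
  refine tendsto_of_weightedMean_slowlyDecreasing hp hP hG hmean fun ε hε => ?_
  obtain ⟨q, hq, N₀, h⟩ := hso ε hε
  exact ⟨q, hq, N₀, fun N i h0 h1 h2 => by have := (abs_le.mp (h N i h0 h1 h2)).1; linarith⟩

/-- **IN THE CLASS (SO), UNDER (G): `W → m ⟺ a → m`** (⟹ the weighted Tauberian theorem; ⟸ regularity `weightedMean_of_tendsto`). [folklore] -/
theorem weightedMean_iff_tendsto_of_slowlyOscillating (hp : ∀ n, 0 ≤ p n)
    (hP : Tendsto (fun N => ∑ n ∈ range N, p n) atTop atTop)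
    (hG : ∀ q > (1:ℝ), ∃ ρ > (1:ℝ), ∃ N₁ : ℕ, ∀ N J : ℕ, N₁ ≤ N → q * N ≤ (J : ℝ) →
      ρ * (∑ n ∈ range N, p n) ≤ ∑ n ∈ range J, p n)
    (hso : ∀ ε > 0, ∃ q > (1:ℝ), ∃ N₀ : ℕ, ∀ N i : ℕ, N₀ ≤ N → N ≤ i → (i : ℝ) ≤ q * N → |a i - a N| ≤ ε) (m : ℝ) :
    Tendsto (fun N => (∑ n ∈ range N, p n * a n) / ∑ n ∈ range N, p n) atTop (𝓝 m) ↔ Tendsto a atTop (𝓝 m) :=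
  ⟨fun h => tendsto_of_weightedMean_slowlyOscillating hp hP hG h hso, weightedMean_of_tendsto hp hP⟩

end

end Summit.QuantumFields.BalabanUV.Beta.EriceFlowEnclosureWeightedTauberianSeq
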